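import Literature.Geometry.Lorentzian.Genericity
import Literature.Geometry.Lorentzian.ModelData
import Mathlib.Analysis.Calculus.ContDiff.WithLp
import Mathlib.Analysis.InnerProductSpace.Calculus

/-!
# Christodoulou's curve-genericity is not closed under conjunction — part 1: the model data space
# (negative-side support for crux `TameCensorship`, `stmt-FinalStateConjecture-10047`)

The crux `TameCensorship` of route `PhotonSphereChannels` bundles weak cosmic censorship, a
dynamical third law and a-priori tameness into ONE Christodoulou-generic property
(`InitialDataSet.IsChristodoulouGeneric … 1`, `Literature/Geometry/Lorentzian/Genericity.lean`),
and the route's two-layer plan foresees gluing it from the three separately generic parts. This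
file and its sequel `GenericityAndFails.lean` prove that such a glue step is not available as
pure logic (`isChristodoulouGeneric_and_fails`, `not_isChristodoulouGeneric_and_closed` there).
This part builds the MODEL DATA SPACE: initial data sets on the Minkowski slice with the tensor
`k` shifted by explicit smooth symmetric sections (`addK`, `fam`), the observable `Φ`, joint
smoothness of the families (`isSmoothDataFamily_fam`) and continuity of the observable along a
smooth family (`continuous_k_apply`); the plumbing lemmas reduce smoothness of sections of the
bundle of bilinear forms over an open subset of a normed space to plain smoothness (the
trivializations are the identity, as in the tree's `OpensSection.contMDiff_bilinSection`).

Sequel's model, for orientation: the observable `Φ(D) = (k(0)(e, e), k(e)(e, e)) ∈ ℝ²`; exceptional set of `P` = origin and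
closed upper semicircles of radii `1/(n+1)`, of `Q` = open lower semicircles. Each is escaped from
every point by a smooth injective family (radial, with a bounded `arctan` reparametrisation that
never reaches a neighbouring circle; or parabolic from the origin), but their union contains whole
circles shrinking to `Φ(trivialData) = 0`, so every smooth family through the trivial datum meets it
at a nonzero parameter (intermediate value theorem on the squared radius). The plumbing lemmas
reduce smoothness of sections of the bundle of bilinear forms over an open subset of a normed space
to plain smoothness (trivializations are the identity).
-/

noncomputable section

open Bundle TopologicalSpace Manifold Set
open scoped ContDiff Topology InnerProductSpace RealInnerProductSpace

namespace Summit.FinalStateConjecture.FinalStateConjecture.Theorems.TameCensorship.Negative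

open Literature.Geometry.Lorentzian

section Plumbing

variable {F : Type*} [NormedAddCommGroup F] [NormedSpace ℝ F]

/-- Over an open subset `U` of a normed space the preferred trivialization of the bundle of
bilinear forms on `T U` is the identity on fibres (extracted from the tree's
`OpensSection.contMDiff_bilinSection`). -/
theorem trivializationAt_bilin_snd (U : Opens F) (x₀ y : U) (b : F →L[ℝ] F →L[ℝ] ℝ) :
    ((trivializationAt (F →L[ℝ] F →L[ℝ] ℝ)
      (fun x : U ↦ TangentSpace 𝓘(ℝ, F) x →L[ℝ] TangentSpace 𝓘(ℝ, F) x →L[ℝ] ℝ) x₀)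
        ⟨y, b⟩).2 = b := by
  ext v w
  rw [hom_trivializationAt_apply]
  simp only [ContinuousLinearMap.inCoordinates, ContinuousLinearMap.comp_apply]
  rw [OpensSection.symmL_apply, Trivialization.continuousLinearMapAt_apply,
    Trivialization.linearMapAt_apply,
    if_pos (by simpa [hom_trivializationAt_baseSet] using OpensSection.mem_chartAt_source U x₀ y)]
  change ((trivializationAt (F →L[ℝ] ℝ)
    (fun x : U ↦ TangentSpace 𝓘(ℝ, F) x →L[ℝ] Bundle.Trivial U ℝ x) x₀) ⟨y, b v⟩).2 w = b v w
  rw [hom_trivializationAt_apply]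
  simp only [ContinuousLinearMap.inCoordinates, ContinuousLinearMap.comp_apply]
  rw [OpensSection.symmL_apply]
  simp
  rfl

/-- Maps into the total space of the bundle of bilinear forms on `T U` (`U` open in a normed
space) are `C^n` iff base and fibre components are (the trivializations being the identity). -/
theorem contMDiffAt_totalSpace_bilin_iff {EN : Type*} [NormedAddCommGroup EN] [NormedSpace ℝ EN]
    {HN : Type*} [TopologicalSpace HN] {J : ModelWithCorners ℝ EN HN} {N : Type*}
    [TopologicalSpace N] [ChartedSpace HN N] (U : Opens F) {n : ℕ∞ω}
    (g : N → U) (s : N → F →L[ℝ] F →L[ℝ] ℝ) (z₀ : N) :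
    ContMDiffAt J (𝓘(ℝ, F).prod 𝓘(ℝ, F →L[ℝ] F →L[ℝ] ℝ)) n
      (fun z : N ↦ TotalSpace.mk' (F →L[ℝ] F →L[ℝ] ℝ)
        (E := fun x : U ↦ TangentSpace 𝓘(ℝ, F) x →L[ℝ] TangentSpace 𝓘(ℝ, F) x →L[ℝ] ℝ)
        (g z) (s z)) z₀ ↔
    ContMDiffAt J 𝓘(ℝ, F) n g z₀ ∧ ContMDiffAt J 𝓘(ℝ, F →L[ℝ] F →L[ℝ] ℝ) n s z₀ := by
  rw [contMDiffAt_totalSpace]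
  simp only [trivializationAt_bilin_snd]

end Plumbing

/-! ### A model data space: data on the Minkowski slice `ℝ³`, varying the tensor `k` -/

/-- Initial data sets on the Minkowski slice `ℝ³`. -/
abbrev SliceData : Type := InitialDataSet 𝓘(ℝ, E3) Minkowski.slice

/-- The bilinear-form type of the fibres. -/
abbrev Bil : Type := E3 →L[ℝ] E3 →L[ℝ] ℝ

/-- A fibre bilinear form on `T_x slice = E3` viewed in `Bil` (identity). -/
def toBil {x : Minkowski.slice}
    (b : TangentSpace 𝓘(ℝ, E3) x →L[ℝ] TangentSpace 𝓘(ℝ, E3) x →L[ℝ] ℝ) : Bil := b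

/-- An element of `Bil` viewed as a fibre bilinear form on `T_x slice` (identity). -/
def ofBil (x : Minkowski.slice) (b : Bil) :
    TangentSpace 𝓘(ℝ, E3) x →L[ℝ] TangentSpace 𝓘(ℝ, E3) x →L[ℝ] ℝ := b

/-- `toBil` is the identity on values. -/
@[simp] theorem toBil_apply {x : Minkowski.slice}
    (b : TangentSpace 𝓘(ℝ, E3) x →L[ℝ] TangentSpace 𝓘(ℝ, E3) x →L[ℝ] ℝ) (v w : E3) :
    toBil b v w = b v w := rfl

/-- `ofBil` is the identity on values. -/
@[simp] theorem ofBil_apply (x : Minkowski.slice) (b : Bil) (v w : E3) :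
    ofBil x b v w = b v w := rfl

/-- The tensor `k` of a data set as a plain map `slice → Bil`. -/
def kBil (D : SliceData) : Minkowski.slice → Bil := fun x ↦ toBil (D.k x)

/-- `kBil` evaluates as `k`. -/
@[simp] theorem kBil_apply (D : SliceData) (x : Minkowski.slice) (v w : E3) :
    kBil D x v w = D.k x v w := rfl

/-- Data sets with the same `h` and the same `k` are equal. -/
theorem sliceData_ext {D D' : SliceData} (hh : D.h = D'.h) (hk : D.k = D'.k) : D = D' := by
  cases D; cases D'; cases hh; cases hk; rfl

/-- Over the slice, bundle smoothness of a bilinear section is plain smoothness. -/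
theorem contMDiff_section_iff (k : Minkowski.slice → Bil) :
    ContMDiff 𝓘(ℝ, E3) (𝓘(ℝ, E3).prod 𝓘(ℝ, Bil)) ∞
      (fun x : Minkowski.slice ↦ TotalSpace.mk' Bil
        (E := fun y : Minkowski.slice ↦
          TangentSpace 𝓘(ℝ, E3) y →L[ℝ] TangentSpace 𝓘(ℝ, E3) y →L[ℝ] ℝ) x (k x)) ↔
    ContMDiff 𝓘(ℝ, E3) 𝓘(ℝ, Bil) ∞ k := by
  constructor
  · intro h x
    exact ((contMDiffAt_totalSpace_bilin_iff Minkowski.slice id k x).1 (h x)).2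
  · intro h x
    exact (contMDiffAt_totalSpace_bilin_iff Minkowski.slice id k x).2 ⟨contMDiffAt_id, h x⟩

/-- The tensor `k` of a data set on the slice is smooth as a plain map. -/
theorem contMDiff_kBil (D : SliceData) : ContMDiff 𝓘(ℝ, E3) 𝓘(ℝ, Bil) ∞ (kBil D) :=
  (contMDiff_section_iff _).1 D.contMDiff_k

/-- Add a smooth symmetric bilinear section `β` to the tensor `k` of a data set. -/
def addK (D : SliceData) (β : Minkowski.slice → Bil) (hβs : ∀ x v w, β x v w = β x w v)
    (hβ : ContMDiff 𝓘(ℝ, E3) 𝓘(ℝ, Bil) ∞ β) : SliceData where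
  h := D.h
  k x := ofBil x (kBil D x + β x)
  k_symm x v w := by
    show D.k x v w + β x v w = D.k x w v + β x w v
    rw [D.k_symm x v w, hβs x v w]
  contMDiff_k := (contMDiff_section_iff (fun x ↦ kBil D x + β x)).2 ((contMDiff_kBil D).add hβ)

/-- `addK` does not change the metric `h`. -/
@[simp] theorem addK_h (D : SliceData) (β : Minkowski.slice → Bil) (hβs hβ) :
    (addK D β hβs hβ).h = D.h := rfl

/-- `addK` adds `β` to `k`, pointwise. -/
@[simp] theorem addK_k_apply (D : SliceData) (β : Minkowski.slice → Bil) (hβs hβ)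
    (y : Minkowski.slice) (v w : E3) :
    (addK D β hβs hβ).k y v w = D.k y v w + β y v w := rfl

/-- The unit vector `e = e₀ ∈ ℝ³`. -/
def e : E3 := EuclideanSpace.single (0 : Fin 3) (1 : ℝ)

/-- `e` is a unit vector. -/
theorem norm_e : ‖e‖ = 1 := by simp [e]

/-- `⟪e, e⟫ = 1`. -/
theorem inner_e_e : ⟪e, e⟫ = 1 := by
  rw [real_inner_self_eq_norm_sq, norm_e]; norm_num

/-- The two evaluation points `0, e` of the slice. -/
def p₀ : Minkowski.slice := ⟨0, Minkowski.mem_slice _⟩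

/-- The second evaluation point `e`. -/
def p₁ : Minkowski.slice := ⟨e, Minkowski.mem_slice _⟩

/-- `p₀` is the origin. -/
@[simp] theorem coe_p₀ : (p₀ : E3) = 0 := rfl
/-- `p₁` is the point `e`. -/
@[simp] theorem coe_p₁ : (p₁ : E3) = e := rfl

/-- The scalar profile `a (1 - ⟪x, e⟫) + b ⟪x, e⟫`, worth `a` at `0` and `b` at `e`. -/
def βfun (a b : ℝ) (x : E3) : ℝ := a * (1 - ⟪x, e⟫) + b * ⟪x, e⟫

/-- The ambient section `x ↦ βfun a b x • δ` (`δ = innerSL`, the Euclidean form). -/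
def βamb (a b : ℝ) (x : E3) : Bil :=
  βfun a b x • (innerSL ℝ (E := E3) : Bil)

/-- Evaluation of the ambient section (by `rfl`). -/
theorem βamb_apply (a b : ℝ) (x v w : E3) :
    βamb a b x v w = (a * (1 - ⟪x, e⟫) + b * ⟪x, e⟫) * ⟪v, w⟫ := rfl

/-- The ambient section is symmetric. -/
theorem βamb_symm (a b : ℝ) (x v w : E3) : βamb a b x v w = βamb a b x w v := by
  rw [βamb_apply, βamb_apply, real_inner_comm v w]

/-- Joint smoothness of `(a, b, x) ↦ βamb a b x` (via the tree's `contDiffOn_smul_const'`,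
stated for a generic normed target so that no instance diamond on `Bil` arises). -/
theorem contDiff_βamb : ContDiff ℝ ∞ (fun q : (ℝ × ℝ) × E3 ↦ βamb q.1.1 q.1.2 q.2) := by
  have hi : ContDiff ℝ ∞ (fun q : (ℝ × ℝ) × E3 ↦ ⟪q.2, e⟫) := contDiff_snd.inner ℝ contDiff_const
  have hs : ContDiff ℝ ∞ (fun q : (ℝ × ℝ) × E3 ↦ βfun q.1.1 q.1.2 q.2) :=
    ((contDiff_fst.comp contDiff_fst).mul (contDiff_const.sub hi)).add
      ((contDiff_snd.comp contDiff_fst).mul hi)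
  exact contDiffOn_univ.1 (contDiffOn_smul_const' hs.contDiffOn (innerSL ℝ (E := E3) : Bil))

/-- The ambient section restricted to the slice is smooth as a plain map. -/
theorem contMDiff_βamb_slice (a b : ℝ) :
    ContMDiff 𝓘(ℝ, E3) 𝓘(ℝ, Bil) ∞ (fun x : Minkowski.slice ↦ βamb a b x) :=
  ((contDiff_βamb.comp ((contDiff_const (c := (a, b))).prodMk contDiff_id)).contMDiff).comp
    contMDiff_subtype_val

/-- The observable `Φ(D) = (k(0)(e,e), k(e)(e,e)) ∈ ℝ²`. -/
def Φ (D : SliceData) : ℝ × ℝ := (D.k p₀ e e, D.k p₁ e e)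

/-- The one-parameter family `k_c = k + βamb (a c₀) (b c₀)`. -/
def fam (D : SliceData) (a b : ℝ → ℝ) (c : EuclideanSpace ℝ (Fin 1)) : SliceData :=
  addK D (fun x ↦ βamb (a (c 0)) (b (c 0)) x) (fun x v w ↦ βamb_symm _ _ x v w)
    (contMDiff_βamb_slice _ _)

/-- The family does not change the metric `h`. -/
@[simp] theorem fam_h (D : SliceData) (a b : ℝ → ℝ) (c : EuclideanSpace ℝ (Fin 1)) :
    (fam D a b c).h = D.h := rfl

/-- Evaluation of the tensor `k` along the family (by `rfl`). -/
theorem fam_k_apply (D : SliceData) (a b : ℝ → ℝ) (c : EuclideanSpace ℝ (Fin 1))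
    (x : Minkowski.slice) (v w : E3) :
    (fam D a b c).k x v w = D.k x v w + βamb (a (c 0)) (b (c 0)) x v w := rfl

/-- Recover the parameter from the family. -/
theorem fam_k_p₀ (D : SliceData) (a b : ℝ → ℝ) (c : EuclideanSpace ℝ (Fin 1)) :
    (fam D a b c).k p₀ e e = D.k p₀ e e + a (c 0) := by
  rw [fam_k_apply, βamb_apply, coe_p₀, inner_zero_left, inner_e_e]; ring

/-- The observable at `p₁` along the family: `k(e)(e,e) + b(c₀)`. -/
theorem fam_k_p₁ (D : SliceData) (a b : ℝ → ℝ) (c : EuclideanSpace ℝ (Fin 1)) :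
    (fam D a b c).k p₁ e e = D.k p₁ e e + b (c 0) := by
  rw [fam_k_apply, βamb_apply, coe_p₁, inner_e_e]; ring

/-- The observable along the family is translated by `(a(c₀), b(c₀))`. -/
theorem Φ_fam (D : SliceData) (a b : ℝ → ℝ) (c : EuclideanSpace ℝ (Fin 1)) :
    Φ (fam D a b c) = ((Φ D).1 + a (c 0), (Φ D).2 + b (c 0)) := by
  simp only [Φ, fam_k_p₀, fam_k_p₁]

/-- At the parameter `0` the family passes through `D` (if `a 0 = b 0 = 0`). -/
theorem fam_zero (D : SliceData) (a b : ℝ → ℝ) (ha : a 0 = 0) (hb : b 0 = 0) :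
    fam D a b 0 = D := by
  refine sliceData_ext rfl (funext fun x ↦ ?_)
  ext v w
  rw [fam_k_apply, βamb_apply]
  simp [ha, hb]

/-- Points of `ℝ¹` are determined by their single coordinate. -/
theorem euclid1_ext {c c' : EuclideanSpace ℝ (Fin 1)} (h : c 0 = c' 0) : c = c' := by
  ext i
  fin_cases i
  exact h

/-- A nonzero point of `ℝ¹` has nonzero coordinate. -/
theorem euclid1_ne_zero {c : EuclideanSpace ℝ (Fin 1)} (h : c ≠ 0) : c 0 ≠ 0 := by
  intro h0
  exact h (euclid1_ext (by simpa using h0))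

/-- The family is jointly smooth (`IsSmoothDataFamily 1`). -/
theorem isSmoothDataFamily_fam (D : SliceData) {a b : ℝ → ℝ} (ha : ContDiff ℝ ∞ a)
    (hb : ContDiff ℝ ∞ b) : InitialDataSet.IsSmoothDataFamily 1 (fam D a b) := by
  refine ⟨?_, ?_⟩
  · exact D.h.contMDiff.comp contMDiff_snd
  intro q
  refine (contMDiffAt_totalSpace_bilin_iff Minkowski.slice Prod.snd
    (fun q : EuclideanSpace ℝ (Fin 1) × Minkowski.slice ↦
      kBil D q.2 + βamb (a (q.1 0)) (b (q.1 0)) (q.2 : E3)) q).2 ⟨contMDiffAt_snd, ?_⟩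
  have h0 : ContDiff ℝ ∞ (fun c : EuclideanSpace ℝ (Fin 1) ↦ c 0) :=
    contDiff_piLp_apply (p := 2) (i := (0 : Fin 1))
  have h1 : ContDiff ℝ ∞ (fun q : EuclideanSpace ℝ (Fin 1) × E3 ↦
      βamb (a (q.1 0)) (b (q.1 0)) q.2) :=
    contDiff_βamb.comp (((ha.comp (h0.comp contDiff_fst)).prodMk
      (hb.comp (h0.comp contDiff_fst))).prodMk contDiff_snd)
  have h2 : ContMDiff (𝓘(ℝ, EuclideanSpace ℝ (Fin 1)).prod 𝓘(ℝ, E3))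
      𝓘(ℝ, EuclideanSpace ℝ (Fin 1) × E3) ∞
      (fun q : EuclideanSpace ℝ (Fin 1) × Minkowski.slice ↦ (q.1, (q.2 : E3))) :=
    contMDiff_fst.prodMk_space (contMDiff_subtype_val.comp contMDiff_snd)
  exact (((contMDiff_kBil D).comp contMDiff_snd) q).add ((h1.comp_contMDiff h2) q)

/-- Continuity of `t ↦ k_{γ(t)}(p)(v, w)` along a smooth parameter curve `γ` for a smooth family. -/
theorem continuous_k_apply {F : EuclideanSpace ℝ (Fin 1) → SliceData}
    (hF : InitialDataSet.IsSmoothDataFamily 1 F) {γ : ℝ → EuclideanSpace ℝ (Fin 1)}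
    (hγ : ContMDiff 𝓘(ℝ, ℝ) 𝓘(ℝ, EuclideanSpace ℝ (Fin 1)) ∞ γ) (p : Minkowski.slice)
    (v w : E3) : Continuous fun t ↦ (F (γ t)).k p v w := by
  have h1 : ContMDiff 𝓘(ℝ, ℝ) ((𝓘(ℝ, EuclideanSpace ℝ (Fin 1))).prod 𝓘(ℝ, E3)) ∞
      (fun t ↦ (γ t, p)) := hγ.prodMk contMDiff_const
  have h2 : ContMDiff 𝓘(ℝ, ℝ) (𝓘(ℝ, E3).prod 𝓘(ℝ, Bil)) ∞
      (fun t ↦ TotalSpace.mk' Bil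
        (E := fun y : Minkowski.slice ↦
          TangentSpace 𝓘(ℝ, E3) y →L[ℝ] TangentSpace 𝓘(ℝ, E3) y →L[ℝ] ℝ) p
            (kBil (F (γ t)) p)) :=
    hF.2.comp h1
  have h3 : ContMDiff 𝓘(ℝ, ℝ) 𝓘(ℝ, Bil) ∞ (fun t ↦ kBil (F (γ t)) p) := fun t ↦
    ((contMDiffAt_totalSpace_bilin_iff Minkowski.slice (fun _ ↦ p)
      (fun t ↦ kBil (F (γ t)) p) t).1 (h2 t)).2
  exact (h3.continuous.clm_apply continuous_const).clm_apply continuous_const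


end Summit.FinalStateConjecture.FinalStateConjecture.Theorems.TameCensorship.Negative

end
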